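import Mathlib
import HarnessLib
import Summits.PneNP.PneNP.Theorems.ExpanderLinearGeneratorsFreeCayleyPingPong

/-!
# PneNP / ExpanderLinearGenerators — Cayley graphs without short relations are locally sparse
(stmt-PneNP-11443, helper file 2 of the non-vacuity construction)

Route `PneNP/ExpanderLinearGenerators`, support item stmt-PneNP-11443
(`LinearGeneratorDepthFregeHard`). Second step of the construction of unsolvable `16`-sparse
boundary-expanding systems (see `ExpanderLinearGeneratorsFreeCayleyPingPong.lean`): in a finite
group `Γ` with eight marked elements `g_k` (letters `σ = (k, ±)`, `g (k,-) = (g (k,+))⁻¹`) that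
satisfy NO nonempty reduced relation of length `≤ 2R`, every set `F` of at most `2^R` group
elements spans at most `2|F|` edges `{x, g_k x}` of the (left) Cayley graph. Proof (the Moore
bound, organised as in Alon–Hoory–Linial): if `F` spans more than `2|F|` edges, peeling
elements with `≤ 2` neighbours leaves a nonempty `K ⊆ F` all of whose elements have `≥ 3`
Cayley neighbours in `K` (`exists_core`); from `x₀ ∈ K` there are `≥ 3 · 2^(t-1)`
non-backtracking words of length `t` whose trajectory stays in `K` (`card_walks_ge`), and for
`t = R` their endpoints are pairwise distinct (two words with the same endpoint glue to a reduced
relation of length `≤ 2R`, `exists_relation`), so `|K| ≥ 3 · 2^(R-1) > 2^R ≥ |F|`.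

* `val g w` — the value of a word (head = leftmost factor); `NoShortRelations g L`;
* `exists_relation`, `eq_of_val_eq` — distinct reduced words of length `t` with equal values
  give a nonempty reduced relation of length `≤ 2t`;
* `edgeCount g F` — the number of pairs `(x, k)` with `x, g_k x ∈ F`; `nbrs g K v` — the letters
  `σ` with `g σ · v ∈ K`; `edgeCount_le_of_forall_exists` (peeling), `exists_core`;
* `walks g K x₀ t`, `mem_walks`, `card_walks_ge` (growth), `card_walks_le` (injectivity);
* **`edgeCount_le_two_mul_card`** — `|F| ≤ 2^R`, no reduced relation of length `≤ 2R`
  `⟹ edgeCount F ≤ 2|F|`.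

References: N. Alon, S. Hoory, N. Linial, *The Moore bound for irregular graphs*, Graphs
Combin. 18 (2002) (non-backtracking walk counting); G. A. Margulis, Combinatorica 2 (1982)
(Cayley graphs of `SL₂(ℤ/p)` have logarithmic girth).
-/

namespace Summit.PneNP.PneNP.Theorems

set_option linter.dupNamespace false -- `Summit.PneNP.PneNP.…`: summit = sub-problem (D-0017)

namespace FreeCayley

open Finset

variable {Γ : Type*} [Group Γ] (g : Letter → Γ)

/-! ### Values of words and relations -/

/-- The value of a word in `Γ` (head = leftmost factor). [folklore] -/
def val (w : List Letter) : Γ := (w.map g).prod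

/-- Value of the empty word. [folklore] -/
@[simp] theorem val_nil : val g [] = 1 := by simp [val]

/-- Value of a cons. [folklore] -/
@[simp] theorem val_cons (σ : Letter) (w : List Letter) : val g (σ :: w) = g σ * val g w := by
  simp [val]

/-- Value of a concatenation. [folklore] -/
@[simp] theorem val_append (u w : List Letter) : val g (u ++ w) = val g u * val g w := by
  simp [val]

variable {g}

/-- Value of the formal inverse (when `g` respects formal inverses). [folklore] -/
theorem val_invWord (hg : ∀ σ, g σ.bar = (g σ)⁻¹) (w : List Letter) :
    val g (invWord w) = (val g w)⁻¹ := by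
  induction w with
  | nil => simp [invWord]
  | cons σ w ih => rw [invWord_cons, val_append, ih, val_cons, val_cons, val_nil, hg]; group

variable (g) in
/-- `Γ` has NO SHORT RELATIONS up to length `L` in the marked elements: no nonempty reduced
word of length `≤ L` has value `1`. [folklore] -/
def NoShortRelations (L : ℕ) : Prop :=
  ∀ w : List Letter, IsReduced w → w ≠ [] → w.length ≤ L → val g w ≠ 1

/-- Monotonicity of `NoShortRelations` in the length. [folklore] -/
theorem NoShortRelations.mono {L L' : ℕ} (h : NoShortRelations g L) (hL : L' ≤ L) :
    NoShortRelations g L' :=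
  fun w hw hne hlen => h w hw hne (hlen.trans hL)

/-- Under `NoShortRelations g 1` no marked element is trivial. [folklore] -/
theorem NoShortRelations.g_ne_one {L : ℕ} (h : NoShortRelations g L) (hL : 1 ≤ L) (σ : Letter) :
    g σ ≠ 1 := by
  have := h [σ] (isReduced_singleton σ) (by simp) (by simpa using hL)
  simpa using this

/-- **Gluing.** Two DISTINCT reduced words of the same length with the same value give a
nonempty reduced relation of at most twice the length. [folklore] -/
theorem exists_relation (hg : ∀ σ, g σ.bar = (g σ)⁻¹) :
    ∀ (u u' : List Letter), IsReduced u → IsReduced u' → u.length = u'.length →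
      val g u = val g u' → u ≠ u' →
      ∃ z : List Letter, IsReduced z ∧ z ≠ [] ∧ z.length ≤ u.length + u'.length ∧ val g z = 1
  | [], u', _, _, hlen, _, hne => by
    exfalso; apply hne
    cases u' with
    | nil => rfl
    | cons _ _ => simp at hlen
  | σ :: p, [], _, _, hlen, _, _ => by simp at hlen
  | σ :: p, σ' :: p', hu, hu', hlen, hval, hne => by
    by_cases hσ : σ = σ'
    · subst hσ
      have hp : p ≠ p' := fun h => hne (by rw [h])
      have hval' : val g p = val g p' := by
        rw [val_cons, val_cons] at hval
        exact mul_left_cancel hval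
      obtain ⟨z, hz, hzne, hzlen, hzval⟩ :=
        exists_relation hg p p' hu.tail hu'.tail (by simpa using hlen) hval' hp
      exact ⟨z, hz, hzne, by simp; omega, hzval⟩
    · refine ⟨invWord (σ' :: p') ++ (σ :: p), isReduced_invWord_append hu hu' hσ, by simp, ?_, ?_⟩
      · simp; omega
      · rw [val_append, val_invWord hg, hval, inv_mul_cancel]

/-- **No short relations make values injective on reduced words of a fixed length.**
[folklore] -/
theorem eq_of_val_eq (hg : ∀ σ, g σ.bar = (g σ)⁻¹) {t : ℕ} (hL : NoShortRelations g (2 * t))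
    {u u' : List Letter} (hu : IsReduced u) (hu' : IsReduced u') (hlen : u.length = t)
    (hlen' : u'.length = t) (h : val g u = val g u') : u = u' := by
  by_contra hne
  obtain ⟨z, hz, hzne, hzlen, hzval⟩ := exists_relation hg u u' hu hu' (by omega) h hne
  exact hL z hz hzne (by omega) hzval

/-! ### Edges of the left Cayley graph inside a set; peeling -/

variable [DecidableEq Γ]

variable (g) in
/-- The number of Cayley edges spanned by `F`: pairs `(x, k)` with `x ∈ F` and `g_k · x ∈ F`.
[folklore] -/
def edgeCount (F : Finset Γ) : ℕ :=
  ((F ×ˢ (Finset.univ : Finset (Fin 8))).filter fun p => g (p.2, true) * p.1 ∈ F).card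

variable (g) in
/-- The letters leading from `v` into `K`: `σ` with `g σ · v ∈ K` (the `K`-degree of `v` in
the left Cayley graph is their number). [folklore] -/
def nbrs (K : Finset Γ) (v : Γ) : Finset Letter :=
  Finset.univ.filter fun σ => g σ * v ∈ K

/-- Membership in `nbrs`. [folklore] -/
@[simp] theorem mem_nbrs {K : Finset Γ} {v : Γ} {σ : Letter} : σ ∈ nbrs g K v ↔ g σ * v ∈ K := by
  simp [nbrs]

/-- Membership in the edge set counted by `edgeCount`. [folklore] -/
theorem mem_edges {F : Finset Γ} {p : Γ × Fin 8} :
    p ∈ (F ×ˢ (Finset.univ : Finset (Fin 8))).filter (fun p => g (p.2, true) * p.1 ∈ F) ↔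
      p.1 ∈ F ∧ g (p.2, true) * p.1 ∈ F := by
  simp

/-- **Removing one element** loses at most its `K`-degree many edges. [folklore] -/
theorem edgeCount_le_erase_add (hg : ∀ σ, g σ.bar = (g σ)⁻¹) (K : Finset Γ) (v : Γ) :
    edgeCount g K ≤ edgeCount g (K.erase v) + (nbrs g K v).card := by
  classical
  -- the edges at `v`, parametrised by letters
  let touch : Letter → Γ × Fin 8 := fun σ => if σ.2 then (v, σ.1) else (g σ * v, σ.1)
  have hsub : (K ×ˢ (Finset.univ : Finset (Fin 8))).filter (fun p => g (p.2, true) * p.1 ∈ K) ⊆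
      ((K.erase v) ×ˢ (Finset.univ : Finset (Fin 8))).filter
          (fun p => g (p.2, true) * p.1 ∈ K.erase v) ∪ (nbrs g K v).image touch := by
    intro p hp
    rw [mem_edges] at hp
    obtain ⟨hx, hgx⟩ := hp
    rw [Finset.mem_union, mem_edges, Finset.mem_image]
    by_cases h1 : p.1 = v
    · right
      refine ⟨(p.2, true), ?_, ?_⟩
      · rw [mem_nbrs, ← h1]; exact hgx
      · simp [touch, ← h1]
    by_cases h2 : g (p.2, true) * p.1 = v
    · right
      refine ⟨(p.2, false), ?_, ?_⟩
      · rw [mem_nbrs, show ((p.2, false) : Letter) = Letter.bar (p.2, true) from rfl, hg, ← h2]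
        simpa using hx
      · simp only [touch, Bool.false_eq_true, ↓reduceIte]
        rw [show ((p.2, false) : Letter) = Letter.bar (p.2, true) from rfl, hg, ← h2]
        simp
    · left
      exact ⟨Finset.mem_erase.2 ⟨h1, hx⟩, Finset.mem_erase.2 ⟨h2, hgx⟩⟩
  calc edgeCount g K ≤ (((K.erase v) ×ˢ (Finset.univ : Finset (Fin 8))).filter
          (fun p => g (p.2, true) * p.1 ∈ K.erase v) ∪ (nbrs g K v).image touch).card :=
        Finset.card_le_card hsub
    _ ≤ edgeCount g (K.erase v) + ((nbrs g K v).image touch).card := Finset.card_union_le _ _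
    _ ≤ edgeCount g (K.erase v) + (nbrs g K v).card := by
        have := Finset.card_image_le (s := nbrs g K v) (f := touch)
        omega

/-- **Peeling.** If every nonempty `K ⊆ F` has an element with at most `2` Cayley neighbours
in `K`, then `F` spans at most `2|F|` edges. [folklore] -/
theorem edgeCount_le_of_forall_exists (hg : ∀ σ, g σ.bar = (g σ)⁻¹) (F : Finset Γ)
    (h : ∀ K ⊆ F, K.Nonempty → ∃ v ∈ K, (nbrs g K v).card ≤ 2) :
    edgeCount g F ≤ 2 * F.card := by
  suffices aux : ∀ (n : ℕ) (K : Finset Γ), K.card = n → K ⊆ F → edgeCount g K ≤ 2 * n from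
    aux F.card F rfl Finset.Subset.rfl
  intro n
  induction n with
  | zero =>
    intro K hK _
    rw [Finset.card_eq_zero.1 hK]
    simp [edgeCount]
  | succ n ih =>
    intro K hK hKF
    have hne : K.Nonempty := Finset.card_pos.1 (by omega)
    obtain ⟨v, hvK, hv⟩ := h K hKF hne
    have h1 := edgeCount_le_erase_add hg K v
    have h2 := ih (K.erase v) (by rw [Finset.card_erase_of_mem hvK, hK]; rfl)
      ((Finset.erase_subset v K).trans hKF)
    omega

/-- **The 3-core.** A set spanning more than `2|F|` edges contains a nonempty subset all of
whose elements have at least `3` Cayley neighbours inside it. [folklore] -/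
theorem exists_core (hg : ∀ σ, g σ.bar = (g σ)⁻¹) {F : Finset Γ} (h : 2 * F.card < edgeCount g F) :
    ∃ K ⊆ F, K.Nonempty ∧ ∀ v ∈ K, 3 ≤ (nbrs g K v).card := by
  by_contra hno
  push Not at hno
  have := edgeCount_le_of_forall_exists hg F fun K hKF hKne => by
    obtain ⟨v, hv, hlt⟩ := hno K hKF hKne
    exact ⟨v, hv, by omega⟩
  omega

/-! ### Non-backtracking words staying inside `K` -/

variable (g) in
/-- The non-backtracking words of length `t` from `x₀` whose trajectory
`x₀, g σ₁ x₀, g σ₂ g σ₁ x₀, …` stays in `K` (head = the most recent letter). [folklore] -/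
def walks (K : Finset Γ) (x₀ : Γ) : ℕ → Finset (List Letter)
  | 0 => {[]}
  | t + 1 => (walks K x₀ t).biUnion fun w =>
      ((nbrs g K (val g w * x₀)).filter fun σ => ∀ τ ∈ w.head?, τ ≠ σ.bar).image fun σ => σ :: w

/-- Words in `walks … t` are reduced of length `t`, and end in `K` once `t ≥ 1`. [folklore] -/
theorem mem_walks {K : Finset Γ} {x₀ : Γ} :
    ∀ {t : ℕ} {w : List Letter}, w ∈ walks g K x₀ t →
      IsReduced w ∧ w.length = t ∧ (t ≠ 0 → val g w * x₀ ∈ K)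
  | 0, w, hw => by
    simp only [walks, Finset.mem_singleton] at hw
    subst hw
    exact ⟨isReduced_nil, rfl, fun h => (h rfl).elim⟩
  | t + 1, w, hw => by
    simp only [walks, Finset.mem_biUnion, Finset.mem_image, Finset.mem_filter] at hw
    obtain ⟨w', hw', σ, ⟨hσK, hσnb⟩, rfl⟩ := hw
    obtain ⟨hred, hlen, -⟩ := mem_walks hw'
    refine ⟨hred.cons hσnb, by simp [hlen], fun _ => ?_⟩
    rw [val_cons, mul_assoc]
    exact mem_nbrs.1 hσK

/-- The one-step extensions of a word inside `K` number at least its endpoint's `K`-degree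
minus one (only the backtracking letter is excluded). [folklore] -/
theorem card_nbrs_sub_one_le {K : Finset Γ} (w : List Letter) (x : Γ) :
    (nbrs g K x).card - 1 ≤ ((nbrs g K x).filter fun σ => ∀ τ ∈ w.head?, τ ≠ σ.bar).card := by
  classical
  have hsplit := Finset.card_filter_add_card_filter_not
    (s := nbrs g K x) (p := fun σ => ∀ τ ∈ w.head?, τ ≠ σ.bar)
  have hneg : ((nbrs g K x).filter fun σ => ¬ ∀ τ ∈ w.head?, τ ≠ σ.bar).card ≤ 1 := by
    cases w with
    | nil => simp
    | cons τ w =>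
      refine Finset.card_le_one.2 fun a ha b hb => ?_
      simp only [List.head?_cons, Option.mem_def, Option.some.injEq, forall_eq', ne_eq,
        Decidable.not_not, Finset.mem_filter] at ha hb
      exact Letter.bar_inj.1 (ha.2.symm.trans hb.2)
  omega

/-- **Growth.** If every element of `K` has at least `3` Cayley neighbours in `K` and
`x₀ ∈ K`, there are at least `3 · 2^(t-1)` walks of length `t ≥ 1`.
[cite: AlonHooryLinial2002, proof of Thm 1] -/
theorem card_walks_ge {K : Finset Γ} {x₀ : Γ} (hx₀ : x₀ ∈ K) (hK : ∀ v ∈ K, 3 ≤ (nbrs g K v).card) :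
    ∀ t : ℕ, 1 ≤ t → 3 * 2 ^ (t - 1) ≤ (walks g K x₀ t).card := by
  classical
  -- the cardinality of the next level is the sum of the extension counts
  have hlevel : ∀ t, (walks g K x₀ (t + 1)).card =
      ∑ w ∈ walks g K x₀ t,
        ((nbrs g K (val g w * x₀)).filter fun σ => ∀ τ ∈ w.head?, τ ≠ σ.bar).card := by
    intro t
    rw [walks, Finset.card_biUnion]
    · refine Finset.sum_congr rfl fun w _ => ?_
      exact Finset.card_image_of_injective _ fun σ σ' h => by simpa using h
    · intro w _ w' _ hne
      simp only [Function.onFun]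
      rw [Finset.disjoint_left]
      intro l hl hl'
      simp only [Finset.mem_image] at hl hl'
      obtain ⟨σ, -, rfl⟩ := hl
      obtain ⟨σ', -, h⟩ := hl'
      exact hne (by simpa using (List.cons.inj h).2.symm)
  intro t ht
  induction t with
  | zero => omega
  | succ t ih =>
    rcases Nat.eq_zero_or_pos t with rfl | htpos
    · -- level one: all `≥ 3` neighbours of `x₀`
      rw [hlevel]
      simp only [walks, Finset.sum_singleton, val_nil, one_mul]
      have h3 := hK x₀ hx₀
      have := card_nbrs_sub_one_le (g := g) (K := K) ([] : List Letter) x₀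
      simp only [List.head?_nil] at this ⊢
      simpa using h3
    · have ih' := ih htpos
      rw [hlevel]
      have hterm : ∀ w ∈ walks g K x₀ t,
          2 ≤ ((nbrs g K (val g w * x₀)).filter fun σ => ∀ τ ∈ w.head?, τ ≠ σ.bar).card := by
        intro w hw
        obtain ⟨-, -, hend⟩ := mem_walks hw
        have h3 := hK _ (hend (by omega))
        have := card_nbrs_sub_one_le (g := g) (K := K) w (val g w * x₀)
        omega
      have hsum : ∑ w ∈ walks g K x₀ t, 2 ≤
          ∑ w ∈ walks g K x₀ t,
            ((nbrs g K (val g w * x₀)).filter fun σ => ∀ τ ∈ w.head?, τ ≠ σ.bar).card :=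
        Finset.sum_le_sum hterm
      rw [Finset.sum_const, smul_eq_mul] at hsum
      have : 3 * 2 ^ (t + 1 - 1) = 2 * (3 * 2 ^ (t - 1)) := by
        obtain ⟨s, rfl⟩ : ∃ s, t = s + 1 := ⟨t - 1, by omega⟩
        simp [pow_succ]; ring
      rw [this]
      nlinarith

/-- **Injectivity.** With no reduced relation of length `≤ 2t`, the walks of length `t ≥ 1`
have pairwise distinct endpoints in `K`, so there are at most `|K|` of them. [folklore] -/
theorem card_walks_le (hg : ∀ σ, g σ.bar = (g σ)⁻¹) {K : Finset Γ} {x₀ : Γ} {t : ℕ} (ht : 1 ≤ t)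
    (hL : NoShortRelations g (2 * t)) : (walks g K x₀ t).card ≤ K.card := by
  refine Finset.card_le_card_of_injOn (fun w => val g w * x₀) (fun w hw => ?_) ?_
  · exact (mem_walks hw).2.2 (by omega)
  · intro w hw w' hw' h
    have h' : val g w = val g w' := mul_right_cancel h
    exact eq_of_val_eq hg hL (mem_walks hw).1 (mem_walks hw').1 (mem_walks hw).2.1
      (mem_walks hw').2.1 h'

/-- **Local sparsity of Cayley graphs without short relations.** If the marked elements of `Γ`
satisfy no nonempty reduced relation of length `≤ 2R` (`R ≥ 1`), every set `F` of at most
`2^R` elements spans at most `2|F|` Cayley edges. [cite: Margulis1982, main construction] -/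
theorem edgeCount_le_two_mul_card (hg : ∀ σ, g σ.bar = (g σ)⁻¹) {R : ℕ} (hR : 1 ≤ R)
    (hL : NoShortRelations g (2 * R)) (F : Finset Γ) (hF : F.card ≤ 2 ^ R) :
    edgeCount g F ≤ 2 * F.card := by
  by_contra h
  push Not at h
  obtain ⟨K, hKF, ⟨x₀, hx₀⟩, hdeg⟩ := exists_core hg h
  have h1 := card_walks_ge hx₀ hdeg R hR
  have h2 := card_walks_le hg (K := K) (x₀ := x₀) hR hL
  have h3 := Finset.card_le_card hKF
  obtain ⟨s, rfl⟩ : ∃ s, R = s + 1 := ⟨R - 1, by omega⟩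
  rw [Nat.add_sub_cancel] at h1
  rw [pow_succ] at hF
  have h5 : 0 < 2 ^ s := Nat.two_pow_pos s
  omega

end FreeCayley

end Summit.PneNP.PneNP.Theorems
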